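import Literature.Analysis.FluidPDE.SteadyNavierStokesEnergy
import Literature.Analysis.FunctionSpaces.TorusFourierModes
import Literature.Analysis.FunctionSpaces.TorusFluidGlueProofs

/-!
# Stub `stub_dodgerAssembly` of line lojasiewicz-lamb-floor-ladder (crux stmt-AnomalousDissipation-13038):
# helpers for stub_dodgerAssembly, part 2 — linear glue, residual identity, truncations

Helpers for the stub file `TaylorCertificatesSteadyStatesLoudBoundedStubDodgerAssembly.lean`
(S4b of the line, crux `TaylorCertificates.SteadyStatesLoudBounded`), independent of part 1:

* linear glue on `T³`: `(u·∇)u`, `div`, `∫`, `∫‖·‖²`, `‖∇·‖₂²` of `u = V + a • W`;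
* the residual identity `∫⟪(u·∇)u − f, w⟫ = ∫⟪(V·∇)V − f, w⟫ − a (∫⟪W,(V·∇)w⟫ + ∫⟪V,(W·∇)w⟫)`
  for `u = V + a • W` with `(W·∇)W = 0` (antisymmetry of the trilinear form, Temam 1979 Ch. II
  §1.2 Lemma 1.3 = `Torus.integral_inner_convect_eq_neg`) and the Cauchy–Schwarz bound of the
  cross terms `≤ ‖W‖_∞ ‖V‖_{L²} √3 ‖∇w‖_{L²}`; identity and bound of the
  cross terms are packaged as the registered sub-goal `dodgerAssembly_partB`;
* `L²`- and `Ḣ¹`-orthogonality of fields with disjoint Fourier supports (Parseval);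
* bookkeeping for the Fourier truncations `P_N U` of `U ∈ V ⊆ H` (admissible, Bessel
  `∫‖P_N U‖² ≤ ‖U‖²`, enstrophy `‖∇P_N U‖² ≤ ‖∇U‖² < ∞`, no modes beyond `|k| ≤ N`).

All statements are elementary bookkeeping over the tree's torus calculus
(`Literature/Analysis/FunctionSpaces/{TorusCalculus,TorusTrigPoly}.lean`,
`Literature/Analysis/FluidPDE/SteadyNavierStokesEnergy.lean`).
-/

-- `Summit.<Summit>.<Problem>` is the tree's mandated summit-side namespace (CONVENTIONS §2); for this
-- single-conjunct summit the two coincide, so the duplicate is deliberate.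
set_option linter.dupNamespace false

noncomputable section

namespace Summit.AnomalousDissipation.AnomalousDissipation.Theorems.SteadyStatesLoudBounded.DodgerAssembly

open MeasureTheory Filter Topology UnitAddTorus
open scoped InnerProductSpace ENNReal
open Literature.Analysis.FunctionSpaces Literature.Analysis.FluidPDE

variable {V W f w : UnitAddTorus (Fin 3) → EuclideanSpace ℝ (Fin 3)}

/-! ## §1 Linear glue for `V + a • W` on `T³` -/

/-- `(u·∇)u` for `u = V + a • W` (`C¹` fields): the four convective terms. [folklore] -/
theorem convect_add_smul (hV : Torus.IsContDiff 1 V) (hW : Torus.IsContDiff 1 W)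
    (a : ℝ) (x : UnitAddTorus (Fin 3)) :
    Torus.convect (fun y => V y + a • W y) (fun y => V y + a • W y) x =
      Torus.convect V V x + a • Torus.convect V W x + a • Torus.convect W V x +
        (a * a) • Torus.convect W W x := by
  simp only [Torus.convect]
  rw [show (fun y => V y + a • W y) = V + a • W from rfl, Torus.fderiv_add hV (hW.smul a),
    Torus.fderiv_const_smul hW a]
  rw [add_apply, smul_apply, map_add, map_add, map_smul,
    map_smul, smul_add, smul_smul]
  abel

/-- `div (V + a • W) = div V + a div W` for `C¹` fields (trace of the derivative). [folklore] -/
theorem divergence_add_smul (hV : Torus.IsContDiff 1 V)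
    (hW : Torus.IsContDiff 1 W) (a : ℝ) (x : UnitAddTorus (Fin 3)) :
    Torus.divergence (fun y => V y + a • W y) x = Torus.divergence V x + a * Torus.divergence W x := by
  rw [show (fun y => V y + a • W y) = V + a • W from rfl,
    Torus.divergence_eq_trace_fderiv (hV.add (hW.smul a)) x, Torus.divergence_eq_trace_fderiv hV,
    Torus.divergence_eq_trace_fderiv hW, Torus.fderiv_add hV (hW.smul a),
    Torus.fderiv_const_smul hW a, ContinuousLinearMap.toLinearMap_add,
    ContinuousLinearMap.toLinearMap_smul, map_add, map_smul, smul_eq_mul]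

/-- Sums `V + a • W` of divergence-free `C¹` fields are divergence free. [folklore] -/
theorem isDivFree_add_smul (hV : Torus.IsContDiff 1 V) (hW : Torus.IsContDiff 1 W)
    (hVd : Torus.IsDivFree V) (hWd : Torus.IsDivFree W) (a : ℝ) :
    Torus.IsDivFree (fun y => V y + a • W y) := fun x => by
  rw [divergence_add_smul hV hW a x, hVd x, hWd x, mul_zero, add_zero]

/-- Sums `V + a • W` of mean-zero integrable fields have zero mean. [folklore] -/
theorem hasZeroMean_add_smul (hV : Integrable V volume) (hW : Integrable W volume)
    (hV0 : Torus.HasZeroMean V) (hW0 : Torus.HasZeroMean W) (a : ℝ) :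
    Torus.HasZeroMean (fun y => V y + a • W y) := by
  unfold Torus.HasZeroMean at hV0 hW0 ⊢
  have hW' : Integrable (fun x => a • W x) volume := hW.smul a
  show ∫ x, V x + a • W x = 0
  rw [integral_add hV hW', integral_smul, hV0, hW0, smul_zero, add_zero]

/-- `∫ ‖V + a • W‖² = ∫ ‖V‖² + 2a ∫ ⟪V, W⟫ + a² ∫ ‖W‖²` (continuous fields). [folklore] -/
theorem integral_norm_sq_add_smul (hV : Continuous V) (hW : Continuous W) (a : ℝ) :
    ∫ x, ‖V x + a • W x‖ ^ 2 =
      (∫ x, ‖V x‖ ^ 2) + 2 * a * (∫ x, ⟪V x, W x⟫_ℝ) + a ^ 2 * ∫ x, ‖W x‖ ^ 2 := by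
  have h : ∀ x, ‖V x + a • W x‖ ^ 2 =
      ‖V x‖ ^ 2 + 2 * a * ⟪V x, W x⟫_ℝ + a ^ 2 * ‖W x‖ ^ 2 := fun x => by
    rw [norm_add_sq_real, norm_smul, inner_smul_right, mul_pow, Real.norm_eq_abs, sq_abs]
    ring
  simp_rw [h]
  have h1 : Integrable (fun x => ‖V x‖ ^ 2) volume := (hV.norm.pow 2).integrable_unitAddTorus
  have h2 : Integrable (fun x => 2 * a * ⟪V x, W x⟫_ℝ) volume :=
    (continuous_const.mul (hV.inner hW)).integrable_unitAddTorus
  have h3 : Integrable (fun x => a ^ 2 * ‖W x‖ ^ 2) volume :=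
    (continuous_const.mul (hW.norm.pow 2)).integrable_unitAddTorus
  have h12 : Integrable (fun x => ‖V x‖ ^ 2 + 2 * a * ⟪V x, W x⟫_ℝ) volume := h1.add h2
  rw [integral_add h12 h3, integral_add h1 h2, integral_const_mul, integral_const_mul]

/-- Partial derivatives of `V + a • W` (`C¹` fields). [folklore] -/
theorem partialDeriv_add_smul (hV : Torus.IsContDiff 1 V) (hW : Torus.IsContDiff 1 W)
    (a : ℝ) (i : Fin 3) (x : UnitAddTorus (Fin 3)) :
    Torus.partialDeriv i (fun y => V y + a • W y) x =
      Torus.partialDeriv i V x + a • Torus.partialDeriv i W x := by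
  rw [show (fun y => V y + a • W y) = V + a • W from rfl, Torus.partialDeriv_add hV (hW.smul a),
    Pi.add_apply, Torus.partialDeriv_const_smul hW, Pi.smul_apply]

/-- `‖∇(V + a • W)‖₂² = ‖∇V‖₂² + 2a ∑ᵢ ∫ ⟪∂ᵢV, ∂ᵢW⟫ + a² ‖∇W‖₂²` (smooth fields). [folklore] -/
theorem gradNormSq_add_smul (hV : Torus.IsSmooth V) (hW : Torus.IsSmooth W) (a : ℝ) :
    Torus.gradNormSq (fun y => V y + a • W y) =
      Torus.gradNormSq V +
        2 * a * (∫ x, ∑ i, ⟪Torus.partialDeriv i V x, Torus.partialDeriv i W x⟫_ℝ) +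
        a ^ 2 * Torus.gradNormSq W := by
  unfold Torus.gradNormSq
  have hV1 : Torus.IsContDiff 1 V := hV.isContDiff (by simp)
  have hW1 : Torus.IsContDiff 1 W := hW.isContDiff (by simp)
  have h : ∀ x, ∑ i, ‖Torus.partialDeriv i (fun y => V y + a • W y) x‖ ^ 2 =
      ∑ i, ‖Torus.partialDeriv i V x‖ ^ 2 +
        2 * a * ∑ i, ⟪Torus.partialDeriv i V x, Torus.partialDeriv i W x⟫_ℝ +
        a ^ 2 * ∑ i, ‖Torus.partialDeriv i W x‖ ^ 2 := by
    intro x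
    simp_rw [partialDeriv_add_smul hV1 hW1]
    rw [Finset.mul_sum, Finset.mul_sum, ← Finset.sum_add_distrib, ← Finset.sum_add_distrib]
    refine Finset.sum_congr rfl fun i _ => ?_
    rw [norm_add_sq_real, norm_smul, inner_smul_right, mul_pow, Real.norm_eq_abs, sq_abs]
    ring
  simp_rw [h]
  have hc : ∀ i, Continuous (Torus.partialDeriv i V) := fun i => (hV.partialDeriv i).continuous
  have hc' : ∀ i, Continuous (Torus.partialDeriv i W) := fun i => (hW.partialDeriv i).continuous
  have h1 : Integrable (fun x => ∑ i, ‖Torus.partialDeriv i V x‖ ^ 2) volume :=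
    (continuous_finsetSum _ fun i _ => (hc i).norm.pow 2).integrable_unitAddTorus
  have h2 : Integrable
      (fun x => 2 * a * ∑ i, ⟪Torus.partialDeriv i V x, Torus.partialDeriv i W x⟫_ℝ) volume :=
    (continuous_const.mul (continuous_finsetSum _ fun i _ =>
      (hc i).inner (hc' i))).integrable_unitAddTorus
  have h3 : Integrable (fun x => a ^ 2 * ∑ i, ‖Torus.partialDeriv i W x‖ ^ 2) volume :=
    (continuous_const.mul (continuous_finsetSum _ fun i _ =>
      (hc' i).norm.pow 2)).integrable_unitAddTorus
  have h12 : Integrable (fun x => ∑ i, ‖Torus.partialDeriv i V x‖ ^ 2 +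
      2 * a * ∑ i, ⟪Torus.partialDeriv i V x, Torus.partialDeriv i W x⟫_ℝ) volume := h1.add h2
  rw [integral_add h12 h3, integral_add h1 h2, integral_const_mul, integral_const_mul]

/-! ## §2 The residual of `V + a • W`: identity and Cauchy–Schwarz bound of the cross terms -/

/-- **Residual identity.** For smooth divergence-free `V`, `W` with `(W·∇)W = 0`, smooth `f`, `w`
and `u = V + a • W`:
`∫⟪(u·∇)u − f, w⟫ = ∫⟪(V·∇)V − f, w⟫ − a (∫⟪W, (V·∇)w⟫ + ∫⟪V, (W·∇)w⟫)`
(antisymmetry `b(u,v,w) = −b(u,w,v)`, Temam 1979, Ch. II §1.2, Lemma 1.3). [folklore] -/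
theorem residual_add_smul (hV : Torus.IsSmooth V) (hW : Torus.IsSmooth W)
    (hf : Torus.IsSmooth f) (hw : Torus.IsSmooth w) (hVd : Torus.IsDivFree V)
    (hWd : Torus.IsDivFree W) (hWW : ∀ x, Torus.convect W W x = 0) (a : ℝ) :
    ∫ x, ⟪Torus.convect (fun y => V y + a • W y) (fun y => V y + a • W y) x - f x, w x⟫_ℝ =
      (∫ x, ⟪Torus.convect V V x - f x, w x⟫_ℝ) -
        a * ((∫ x, ⟪W x, Torus.convect V w x⟫_ℝ) + ∫ x, ⟪V x, Torus.convect W w x⟫_ℝ) := by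
  have hV1 : Torus.IsContDiff 1 V := hV.isContDiff (by simp)
  have hW1 : Torus.IsContDiff 1 W := hW.isContDiff (by simp)
  have hpt : ∀ x, ⟪Torus.convect (fun y => V y + a • W y) (fun y => V y + a • W y) x - f x, w x⟫_ℝ =
      ⟪Torus.convect V V x - f x, w x⟫_ℝ + a * ⟪Torus.convect V W x, w x⟫_ℝ +
        a * ⟪Torus.convect W V x, w x⟫_ℝ := by
    intro x
    rw [convect_add_smul hV1 hW1 a x, hWW x, smul_zero, add_zero]
    simp only [inner_sub_left, inner_add_left, inner_smul_left, RCLike.conj_to_real]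
    ring
  simp_rw [hpt]
  have h1 : Integrable (fun x => ⟪Torus.convect V V x - f x, w x⟫_ℝ) volume :=
    (((hV.convect hV).sub hf).inner hw).integrable
  have h2 : Integrable (fun x => a * ⟪Torus.convect V W x, w x⟫_ℝ) volume :=
    (((hV.convect hW).inner hw).integrable).const_mul a
  have h3 : Integrable (fun x => a * ⟪Torus.convect W V x, w x⟫_ℝ) volume :=
    (((hW.convect hV).inner hw).integrable).const_mul a
  have h12 : Integrable (fun x => ⟪Torus.convect V V x - f x, w x⟫_ℝ +
      a * ⟪Torus.convect V W x, w x⟫_ℝ) volume := h1.add h2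
  rw [integral_add h12 h3, integral_add h1 h2, integral_const_mul, integral_const_mul,
    Torus.integral_inner_convect_eq_neg hV hVd hW hw, Torus.integral_inner_convect_eq_neg hW hWd hV hw]
  ring

/-- **Cauchy–Schwarz for the cross terms.** If `|g| ≤ B ‖V‖ ∑ᵢ ‖∂ᵢw‖` pointwise (`B ≥ 0`,
`V`, `w` smooth), then `|∫ g| ≤ B √(∫‖V‖²) √(3 ‖∇w‖₂²)` (Hölder with `p = q = 2` and
`(∑ᵢ sᵢ)² ≤ 3 ∑ᵢ sᵢ²`). [folklore] -/
theorem abs_integral_le_of_le_mul (hV : Torus.IsSmooth V) (hw : Torus.IsSmooth w)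
    {B : ℝ} (hB : 0 ≤ B) {g : UnitAddTorus (Fin 3) → ℝ}
    (hg : ∀ x, |g x| ≤ B * (‖V x‖ * ∑ i, ‖Torus.partialDeriv i w x‖)) :
    |∫ x, g x| ≤ B * Real.sqrt (∫ x, ‖V x‖ ^ 2) * Real.sqrt (3 * Torus.gradNormSq w) := by
  set S : UnitAddTorus (Fin 3) → ℝ := fun x => ∑ i, ‖Torus.partialDeriv i w x‖ with hS
  have hSc : Continuous S :=
    continuous_finsetSum _ fun i _ => (hw.partialDeriv i).continuous.norm
  have hVc : Continuous fun x => ‖V x‖ := hV.continuous.norm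
  have hS0 : ∀ x, 0 ≤ S x := fun x => Finset.sum_nonneg fun i _ => norm_nonneg _
  -- `|∫ g| ≤ B ∫ ‖V‖ S`
  have h1 : |∫ x, g x| ≤ B * ∫ x, ‖V x‖ * S x := by
    rw [← integral_const_mul, ← Real.norm_eq_abs]
    exact norm_integral_le_of_norm_le ((continuous_const.mul (hVc.mul hSc)).integrable_unitAddTorus)
      (ae_of_all _ fun x => by rw [Real.norm_eq_abs]; exact hg x)
  -- Hölder `p = q = 2`
  have h2 : ∫ x, ‖V x‖ * S x ≤ Real.sqrt (∫ x, ‖V x‖ ^ 2) * Real.sqrt (∫ x, S x ^ 2) := by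
    have hVm : MemLp (fun x => ‖V x‖) (ENNReal.ofReal 2) volume := by
      simpa using (hV.memLp 2).norm
    have hSm : MemLp S (ENNReal.ofReal 2) volume := by
      have h : MemLp S 2 volume :=
        hSc.memLp_of_hasCompactSupport (HasCompactSupport.of_compactSpace S)
      simpa using h
    have h := integral_mul_le_Lp_mul_Lq_of_nonneg Real.HolderConjugate.two_two
      (ae_of_all _ fun x => norm_nonneg (V x)) (ae_of_all _ fun x => hS0 x) hVm hSm
    refine h.trans_eq ?_
    simp only [Real.rpow_two, one_div, Real.sqrt_eq_rpow]
  -- `∫ S² ≤ 3 ‖∇w‖²`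
  have h3 : ∫ x, S x ^ 2 ≤ 3 * Torus.gradNormSq w := by
    rw [Torus.gradNormSq, ← integral_const_mul]
    refine integral_mono (hSc.pow 2).integrable_unitAddTorus
      ((continuous_const.mul (continuous_finsetSum _ fun i _ =>
        ((hw.partialDeriv i).continuous.norm.pow 2))).integrable_unitAddTorus) fun x => ?_
    have h := sq_sum_le_card_mul_sum_sq (s := (Finset.univ : Finset (Fin 3)))
      (f := fun i => ‖Torus.partialDeriv i w x‖)
    simpa using h
  calc |∫ x, g x| ≤ B * ∫ x, ‖V x‖ * S x := h1
    _ ≤ B * (Real.sqrt (∫ x, ‖V x‖ ^ 2) * Real.sqrt (∫ x, S x ^ 2)) :=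
        mul_le_mul_of_nonneg_left h2 hB
    _ ≤ B * (Real.sqrt (∫ x, ‖V x‖ ^ 2) * Real.sqrt (3 * Torus.gradNormSq w)) := by
        gcongr
    _ = B * Real.sqrt (∫ x, ‖V x‖ ^ 2) * Real.sqrt (3 * Torus.gradNormSq w) := by ring

/-- First cross term: `|∫ ⟪W, (V·∇)w⟫| ≤ B √(∫‖V‖²) √(3‖∇w‖²)` when `‖W x‖ ≤ B`. [folklore] -/
theorem abs_integral_inner_convect_le_left (hV : Torus.IsSmooth V)
    (hw : Torus.IsSmooth w) {B : ℝ} (hB : 0 ≤ B) (hWB : ∀ x, ‖W x‖ ≤ B) :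
    |∫ x, ⟪W x, Torus.convect V w x⟫_ℝ| ≤
      B * Real.sqrt (∫ x, ‖V x‖ ^ 2) * Real.sqrt (3 * Torus.gradNormSq w) := by
  refine abs_integral_le_of_le_mul hV hw hB fun x => ?_
  calc |⟪W x, Torus.convect V w x⟫_ℝ| ≤ ‖W x‖ * ‖Torus.convect V w x‖ := abs_real_inner_le_norm _ _
    _ ≤ B * (‖V x‖ * ∑ i, ‖Torus.partialDeriv i w x‖) :=
        mul_le_mul (hWB x) (Torus.norm_convect_le V (hw.isContDiff (by simp)) x) (norm_nonneg _) hB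

/-- Second cross term: `|∫ ⟪V, (W·∇)w⟫| ≤ B √(∫‖V‖²) √(3‖∇w‖²)` when `‖W x‖ ≤ B`. [folklore] -/
theorem abs_integral_inner_convect_le_right (hV : Torus.IsSmooth V)
    (hw : Torus.IsSmooth w) {B : ℝ} (hB : 0 ≤ B) (hWB : ∀ x, ‖W x‖ ≤ B) :
    |∫ x, ⟪V x, Torus.convect W w x⟫_ℝ| ≤
      B * Real.sqrt (∫ x, ‖V x‖ ^ 2) * Real.sqrt (3 * Torus.gradNormSq w) := by
  refine abs_integral_le_of_le_mul hV hw hB fun x => ?_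
  calc |⟪V x, Torus.convect W w x⟫_ℝ| ≤ ‖V x‖ * ‖Torus.convect W w x‖ := abs_real_inner_le_norm _ _
    _ ≤ ‖V x‖ * (‖W x‖ * ∑ i, ‖Torus.partialDeriv i w x‖) :=
        mul_le_mul_of_nonneg_left (Torus.norm_convect_le W (hw.isContDiff (by simp)) x) (norm_nonneg _)
    _ ≤ ‖V x‖ * (B * ∑ i, ‖Torus.partialDeriv i w x‖) :=
        mul_le_mul_of_nonneg_left (mul_le_mul_of_nonneg_right (hWB x)
          (Finset.sum_nonneg fun i _ => norm_nonneg _)) (norm_nonneg _)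
    _ = B * (‖V x‖ * ∑ i, ‖Torus.partialDeriv i w x‖) := by ring

/-- **Registered sub-goal `dodgerAssembly_partB` (residual of a dressed field).** For smooth
divergence-free `V`, `W` with `(W·∇)W = 0` and `‖W‖ ≤ B`, smooth `f`, `w`, and `a, B ≥ 0`, the Euler
residual of `V + a • W` tested against `w` exceeds that of `V` by at most
`2 a B ‖V‖_{L²} √(3 ‖∇w‖₂²)` (the `a²` term vanishes; cross terms by antisymmetry and
Cauchy–Schwarz). [folklore] -/
theorem dodgerAssembly_partB : ∀ (V W f w : UnitAddTorus (Fin 3) → EuclideanSpace ℝ (Fin 3)) (a B : ℝ),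
    Torus.IsSmooth V → Torus.IsSmooth W → Torus.IsSmooth f → Torus.IsSmooth w → Torus.IsDivFree V →
      Torus.IsDivFree W → (∀ x, Torus.convect W W x = 0) → (∀ x, ‖W x‖ ≤ B) → 0 ≤ a → 0 ≤ B →
      |∫ x, inner ℝ (Torus.convect (fun y => V y + a • W y) (fun y => V y + a • W y) x - f x) (w x)| ≤
        |∫ x, inner ℝ (Torus.convect V V x - f x) (w x)| +
          2 * a * B * Real.sqrt (∫ x, ‖V x‖ ^ 2) * Real.sqrt (3 * Torus.gradNormSq w) := by
  intro V W f w a B hV hW hf hw hVd hWd hWW hWB ha hB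
  rw [residual_add_smul hV hW hf hw hVd hWd hWW a]
  have h2 := abs_integral_inner_convect_le_left hV hw hB hWB
  have h3 := abs_integral_inner_convect_le_right hV hw hB hWB
  calc |(∫ x, ⟪Torus.convect V V x - f x, w x⟫_ℝ) -
        a * ((∫ x, ⟪W x, Torus.convect V w x⟫_ℝ) + ∫ x, ⟪V x, Torus.convect W w x⟫_ℝ)|
      ≤ |∫ x, ⟪Torus.convect V V x - f x, w x⟫_ℝ| +
          |a * ((∫ x, ⟪W x, Torus.convect V w x⟫_ℝ) + ∫ x, ⟪V x, Torus.convect W w x⟫_ℝ)| :=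
        abs_sub _ _
    _ ≤ |∫ x, ⟪Torus.convect V V x - f x, w x⟫_ℝ| +
          a * (|∫ x, ⟪W x, Torus.convect V w x⟫_ℝ| + |∫ x, ⟪V x, Torus.convect W w x⟫_ℝ|) := by
        rw [abs_mul, abs_of_nonneg ha]
        exact add_le_add le_rfl (mul_le_mul_of_nonneg_left (abs_add_le _ _) ha)
    _ ≤ |∫ x, ⟪Torus.convect V V x - f x, w x⟫_ℝ| +
          a * (2 * (B * Real.sqrt (∫ x, ‖V x‖ ^ 2) * Real.sqrt (3 * Torus.gradNormSq w))) :=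
        add_le_add le_rfl (mul_le_mul_of_nonneg_left (by linarith) ha)
    _ = _ := by ring

/-! ## §3 Fields with disjoint Fourier supports are `L²`- and `Ḣ¹`-orthogonal -/

/-- `∫ ⟪V, W⟫ = 0` if at every frequency one of `V̂(k)`, `Ŵ(k)` vanishes (Parseval). [folklore] -/
theorem integral_inner_eq_zero_of_disjoint (hV : MemLp V 2 volume) (hW : MemLp W 2 volume)
    (h : ∀ k : Fin 3 → ℤ, mFourierCoeff (EuclideanSpace.complexify ∘ V) k = 0 ∨
      mFourierCoeff (EuclideanSpace.complexify ∘ W) k = 0) :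
    ∫ x, ⟪V x, W x⟫_ℝ = 0 := by
  have hs := Torus.hasSum_re_inner_mFourierCoeff_complexify hV hW
  have h0 : (fun k : Fin 3 → ℤ => (inner ℂ (mFourierCoeff (EuclideanSpace.complexify ∘ V) k)
      (mFourierCoeff (EuclideanSpace.complexify ∘ W) k)).re) = fun _ => 0 := by
    funext k
    rcases h k with h | h
    · rw [h, inner_zero_left, Complex.zero_re]
    · rw [h, inner_zero_right, Complex.zero_re]
  rw [h0] at hs
  exact hs.unique hasSum_zero

/-- `∑ᵢ ∫ ⟪∂ᵢV, ∂ᵢW⟫ = 0` for smooth fields with disjoint Fourier supports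
(`𝓕(∂ᵢV)(k) = 2πi kᵢ V̂(k)`). [folklore] -/
theorem integral_sum_inner_partialDeriv_eq_zero_of_disjoint (hV : Torus.IsSmooth V)
    (hW : Torus.IsSmooth W)
    (h : ∀ k : Fin 3 → ℤ, mFourierCoeff (EuclideanSpace.complexify ∘ V) k = 0 ∨
      mFourierCoeff (EuclideanSpace.complexify ∘ W) k = 0) :
    ∫ x, ∑ i, ⟪Torus.partialDeriv i V x, Torus.partialDeriv i W x⟫_ℝ = 0 := by
  rw [integral_finsetSum _ fun i _ => ((hV.partialDeriv i).inner (hW.partialDeriv i)).integrable]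
  refine Finset.sum_eq_zero fun i _ => integral_inner_eq_zero_of_disjoint
    ((hV.partialDeriv i).memLp 2) ((hW.partialDeriv i).memLp 2) fun k => ?_
  rcases h k with h | h
  · left
    rw [Torus.mFourierCoeff_complexify_partialDeriv hV i k, h, smul_zero]
  · right
    rw [Torus.mFourierCoeff_complexify_partialDeriv hW i k, h, smul_zero]

/-! ## §4 Fourier truncations `P_N U` of a finite-enstrophy field `U ∈ V` -/

/-- `‖U‖² = ∫ ‖U‖²` for `U ∈ H` (the `L²` norm of the representative). [folklore] -/
theorem norm_sq_eq_integral (U : Torus.energySpace (Fin 3)) :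
    ‖U‖ ^ 2 = ∫ x, ‖((U : Lp (EuclideanSpace ℝ (Fin 3)) 2 (volume : Measure (UnitAddTorus (Fin 3)))) :
      UnitAddTorus (Fin 3) → EuclideanSpace ℝ (Fin 3)) x‖ ^ 2 := by
  -- pattern from Cruxes/SteadyStatesLoudBounded/Disproof.lean §11 (`norm_sq_toH`)
  rw [show ‖U‖ = ‖(U : Lp (EuclideanSpace ℝ (Fin 3)) 2 (volume : Measure (UnitAddTorus (Fin 3))))‖ from rfl,
    ← real_inner_self_eq_norm_sq, MeasureTheory.L2.inner_def]
  exact integral_congr_ae (ae_of_all _ fun x => real_inner_self_eq_norm_sq _)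

/-- Bessel: `∫ ‖P_N U‖² ≤ ‖U‖²`. [folklore] -/
theorem integral_norm_sq_fourierTruncate_le_norm_sq (U : Torus.energySpace (Fin 3)) (N : ℕ) :
    ∫ x, ‖Torus.fourierTruncate N
      ((U : Lp (EuclideanSpace ℝ (Fin 3)) 2 (volume : Measure (UnitAddTorus (Fin 3)))) :
        UnitAddTorus (Fin 3) → EuclideanSpace ℝ (Fin 3)) x‖ ^ 2 ≤ ‖U‖ ^ 2 := by
  rw [norm_sq_eq_integral]
  exact Torus.integral_norm_sq_fourierTruncate_le (Lp.memLp _) N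

/-- The truncations of `U ∈ V` have enstrophy at most `‖∇U‖₂² < ∞`. [folklore] -/
theorem gradNormSq_fourierTruncate_le {U : Torus.energySpace (Fin 3)}
    (hV : (U : Lp (EuclideanSpace ℝ (Fin 3)) 2 (volume : Measure (UnitAddTorus (Fin 3)))) ∈
      Torus.energySpaceV (Fin 3)) (N : ℕ) :
    Torus.gradNormSq (Torus.fourierTruncate N
      ((U : Lp (EuclideanSpace ℝ (Fin 3)) 2 (volume : Measure (UnitAddTorus (Fin 3)))) :
        UnitAddTorus (Fin 3) → EuclideanSpace ℝ (Fin 3))) ≤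
      (Torus.eGradNormSq
        ((U : Lp (EuclideanSpace ℝ (Fin 3)) 2 (volume : Measure (UnitAddTorus (Fin 3)))) :
          UnitAddTorus (Fin 3) → EuclideanSpace ℝ (Fin 3))).toReal := by
  rw [Torus.gradNormSq_eq_toReal_eGradNormSq_holds (Torus.isSmooth_fourierTruncate N _)]
  exact ENNReal.toReal_mono (Torus.MemSobolev.eGradNormSq_lt_top hV.2).ne
    (Torus.eGradNormSq_fourierTruncate_le ((Lp.memLp
      (U : Lp (EuclideanSpace ℝ (Fin 3)) 2 (volume : Measure (UnitAddTorus (Fin 3))))).integrable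
        one_le_two) N)

/-- The truncation `P_N U` has no Fourier modes with `|k|² > N²`. [folklore] -/
theorem mFourierCoeff_fourierTruncate_eq_zero (U : Torus.energySpace (Fin 3)) {N : ℕ}
    {k : Fin 3 → ℤ} (hk : (N : ℝ) ^ 2 < Torus.freqNormSq k) :
    mFourierCoeff (EuclideanSpace.complexify ∘ Torus.fourierTruncate N
      ((U : Lp (EuclideanSpace ℝ (Fin 3)) 2 (volume : Measure (UnitAddTorus (Fin 3)))) :
        UnitAddTorus (Fin 3) → EuclideanSpace ℝ (Fin 3))) k = 0 := by
  rw [Torus.mFourierCoeff_fourierTruncate ((Lp.memLp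
      (U : Lp (EuclideanSpace ℝ (Fin 3)) 2 (volume : Measure (UnitAddTorus (Fin 3))))).integrable
        one_le_two), if_neg (Torus.not_mem_freqBall.2 hk)]

/-- Admissibility of the truncations of `U ∈ H`: smooth, divergence free, mean zero
(`Torus.isDivFree_fourierTruncate`, `Torus.hasZeroMean_fourierTruncate_of_mem`). [folklore] -/
theorem fourierTruncate_admissible (U : Torus.energySpace (Fin 3)) (N : ℕ) :
    Torus.IsSmooth (Torus.fourierTruncate N
      ((U : Lp (EuclideanSpace ℝ (Fin 3)) 2 (volume : Measure (UnitAddTorus (Fin 3)))) :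
        UnitAddTorus (Fin 3) → EuclideanSpace ℝ (Fin 3))) ∧
      Torus.IsDivFree (Torus.fourierTruncate N
        ((U : Lp (EuclideanSpace ℝ (Fin 3)) 2 (volume : Measure (UnitAddTorus (Fin 3)))) :
          UnitAddTorus (Fin 3) → EuclideanSpace ℝ (Fin 3))) ∧
      Torus.HasZeroMean (Torus.fourierTruncate N
        ((U : Lp (EuclideanSpace ℝ (Fin 3)) 2 (volume : Measure (UnitAddTorus (Fin 3)))) :
          UnitAddTorus (Fin 3) → EuclideanSpace ℝ (Fin 3))) :=
  ⟨Torus.isSmooth_fourierTruncate N _,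
    Torus.isDivFree_fourierTruncate (Lp.memLp _) (Torus.isWeaklyDivFree_of_mem_energySpace U.2) N,
    Torus.hasZeroMean_fourierTruncate_of_mem U.2 N⟩

end Summit.AnomalousDissipation.AnomalousDissipation.Theorems.SteadyStatesLoudBounded.DodgerAssembly

end
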